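import Summits.BirchSwinnertonDyer.BirchSwinnertonDyer.Theses.SemiOrdinaryEisensteinDescent
import Summits.BirchSwinnertonDyer.BirchSwinnertonDyer.Theorems.SemiOrdinaryEisensteinDescentEisensteinKernelAtThreeRestrictedOfFrameOdd
import Summits.BirchSwinnertonDyer.BirchSwinnertonDyer.Theorems.AdditiveRankOneControlLeOfPoitouTate
import HarnessLib

/-!
# Route `SemiOrdinaryEisensteinDescent`: the RESTRICTED KERNEL consumes crux #5 `WildSplitControlAtThree` ONLY AS
# `≤` — hence from Poitou–Tate duality for Selmer structures (PT1, item 20461) ALONE — and crux #4 only as a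
# frame-with-value at its own (odd-`d_K`) field: ONE core re-run with both suppliers displayed, and the four
# by-name feeds {V | LZZ + frame-odd} × {C | PT1} (cell `pub/bsd-wall`, width seat `bsd-wall-soed-p1-w3` g6,
# `--supports stmt-BirchSwinnertonDyer-24155`, helper; BSD is not proved by any of this)

WHY. In the restricted kernel (`WildSplitEisensteinInclusionAtThreeRankOneRestriction.wAllExclAddWildRankOneSurj_of_restricted`,
p588074 §3 = item 24156's closer; bed-p3 g1's kernel for E) the UPPER index socket is crux #3 `WildKolyvaginUpperAtThree`
BY NAME, so crux #5 (the pointwise control EQUALITY `SchneiderFree.AdditiveControlOnTreeAt`) is consumed at ONE place: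
the STEP L link `indexLowerBoundLeAt_of_imcLowerLe_of_control` for the LOWER socket — which needs control only as
the INEQUALITY `SchneiderFreeControlAtoms.AdditiveControlLeOnTreeAt … 0 P` + CTL₀ (utd-p3 g6, p593079 §3
`AdditiveRankOneControlLe.indexLowerBoundLeAt_of_imcLowerLe_of_controlLe_zero`). And that inequality holds at EVERY
frame of EVERY Heegner datum of an additive curve at an odd split `p` from `poitouTate_selmerStructure_duality` (PT1)
+ Kolyvagin's theorem for the datum ALONE (p593079 §2 `additiveControlLeOnTreeAt_of_poitouTate_of_heegner`: no PT2
`poitouTate_sha_tateDual`, no local Euler–Poincaré fact, no Serre 1967 — the other open/closed leaves of crux #5's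
split `WildSplitControlAtThreeOfPublishedFacts`). Likewise crux #4 is consumed once, as «frame + unit value at the
kernel's Friedberg–Hoffstein field», where `d_K ≡ 1 (mod 8)` is odd (companion file
`…EisensteinKernelAtThreeRestrictedOfFrameOdd`, p594734).

CONTENTS (0 definitions, 0 named facts, 0 `sorry`; every crux / published input is an ANTECEDENT):
* §1 CORE `wAllExclAddWildRankOneSurj_of_restricted_of_valueOdd_of_controlLe`: `PublishedInputsWildThree →
  WildSplitEisensteinInclusionAtThreeRestricted (crux #2′, 24155, BY NAME) → WildKolyvaginUpperAtThree → hVodd → hCle →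
  WildRankZeroTwistAtThree → WildRankOneSurjNonTowerAtThree → WAllExclAddWildRankOneSurj`, where the two displayed
  suppliers are `hVodd` = crux #4's text with the single binder `Odd (NumberField.discr K)` inserted after the Heegner
  hypothesis (frame AND unit value, at odd `d_K` only) and `hCle` = crux #5's text with its conclusion weakened to
  `AdditiveControlLeOnTreeAt 3 κ 𝔭 γ (embAt K 3 𝔭) 0 P` (the control INEQUALITY at slack `0`, CTL₀ included). Proof =
  the kernel VERBATIM with the `≤`-link of p593079 in place of the equality link.
* §2 the four feeds: `valueOdd_of_waldspurger` (V ⟹ hVodd, parity dropped), `valueOdd_of_lzz_of_frameOdd` (LZZ 20316 +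
  frame at odd `d_K` [20928's text + Odd] ⟹ hVodd, by p594734 §1), `controlLe_of_control` (C ⟹ hCle, p593079
  `additiveControlLeOnTreeAt_zero_of_onTreeAt`), `controlLe_of_poitouTate` (PT1 BY NAME [item 20461's text] ⟹ hCle,
  p593079 §2).
* §3 the by-name kernels: `…_of_waldspurger_of_poitouTate` (PUB → E′ → Ko → V → PT1 → Z → NT → leaf),
  `…_of_frameOdd_of_poitouTate` (PUB → E′ → Ko → LZZ → frame-odd → PT1 → Z → NT → leaf — SOED's kernel with BOTH
  shared cruxes #4, #5 replaced by {one R₀-frame at odd d_K, LZZ, PT1}), and `…_of_waldspurger_of_control` (the item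
  24156 chain recovered from the core — sanity).

READING (for the pen, 0 asks): on the SOED side crux #5 can leave the open-crux cone exactly as utd-p3 g6 reads it for
UTD's hard half — SOED's whole kernel (both sockets) needs from #5 only PT1, because its upper socket is Ko, not
co-STEP L. With p594734, SOED's leaf ⟸ PUB + {E′, Ko, Z, NT} (research) + {frame at odd d_K} (print + port, pen PLAN (B))
+ {LZZ, PT1} (refereed facts by name). HONEST STATUS: bookkeeping; E′ (walls W1–W3), Ko, Z, NT untouched; BSD₃ is
proved for no curve.

References: [JetchevSkinnerWan2017] Thm. 3.3.1, §7.4.1 (arXiv:1512.06894 pp. 11, 30); [MilneADT2006] I Thm. 4.10(b);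
[Howard2004HeegnerKolyvagin] Thm. 2.1.11; [LiuZhangZhang2018] Thm 1.5.1, 1.5.3; [Castella2018] Thm. 2.3, §5;
[GrossZagier1986] Thm. I.(6.3); [FriedbergHoffstein1995] Thm. B; [Kolyvagin1990] Thm. A.
-/

noncomputable section

open scoped Classical NumberField

set_option linter.dupNamespace false -- `Summit.BirchSwinnertonDyer.BirchSwinnertonDyer.Theorems.…` (summit = sub, D-0017)
set_option autoImplicit false

namespace Summit.BirchSwinnertonDyer.BirchSwinnertonDyer.Theorems.EisensteinKernelAtThreeRestrictedOfControlLe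

open WeierstrassCurve NumberField IsDedekindDomain Field PowerSeries
  Literature.NumberTheory.EllipticCurves
  Literature.NumberTheory.EllipticCurves.ModularForms
  Literature.NumberTheory.EllipticCurves.LiuZhangZhang2018
  Literature.NumberTheory.EllipticCurves.Rank1Residual
  Literature.NumberTheory.EllipticCurves.KrizLi2019
  Literature.NumberTheory.GaloisCohomology
  Summit.BirchSwinnertonDyer.Rank1Residual
  Summit.BirchSwinnertonDyer.Rank1Residual.Additive
  Summit.BirchSwinnertonDyer.Rank1Residual.X11b
  Summit.BirchSwinnertonDyer.Rank1Residual.X11b.AcSelmer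
  Summit.BirchSwinnertonDyer.Rank1Residual.X11b.Halves
  Summit.BirchSwinnertonDyer.BirchSwinnertonDyer.Theses.SemiOrdinaryEisensteinDescent
  Summit.BirchSwinnertonDyer.BirchSwinnertonDyer.Theorems
  Summit.BirchSwinnertonDyer.BirchSwinnertonDyer.Theorems.EisensteinKernelAtThreeRestrictedOfFrameOdd

/-! ### §1 CORE: the restricted kernel over two displayed suppliers (value at odd `d_K`; control as `≤`) -/

/-- **CORE RE-RUN of the restricted kernel.** `PublishedInputsWildThree → WildSplitEisensteinInclusionAtThreeRestricted
(crux #2′ BY NAME) → WildKolyvaginUpperAtThree → hVodd → hCle → WildRankZeroTwistAtThree → WildRankOneSurjNonTowerAtThree →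
WAllExclAddWildRankOneSurj`, with `hVodd` = crux #4 `WildSplitWaldspurgerAtThree`'s text restricted to ODD `d_K` (one
binder inserted) and `hCle` = crux #5 `WildSplitControlAtThree`'s text with conclusion the control INEQUALITY at slack `0`.
Proof: the route kernel (bed-p3 g1; p588074 §3 for `E′`) VERBATIM — tower split, Friedberg–Hoffstein with modulus `2`
(so `d_K` odd), Heegner point, Gross–Zagier, Kolyvagin, frame `(κ, γ, 𝔭, 𝔭′)`, value at `𝔭` from `hVodd`, `≤`-control
at `𝔭′` from `hCle`, Eisenstein inclusion at the frame ⟹ T-B6-1 at slack `v₃(c)`, `≤`-link (p593079) ⟹ STEP L,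
Kolyvagin crux ⟹ upper socket, p528981. Every crux / supplier is an antecedent; BSD is not proved by this.
[cite: JetchevSkinnerWan2017, Thm. 3.3.1 and §7.4.1 (arXiv:1512.06894 pp. 11, 30)]
[cite: Castella2018, Thm. 2.3 and §5 (5.1)–(5.3)] [cite: GrossZagier1986, Thm. I.(6.3) and V.§2]
[cite: FriedbergHoffstein1995, Thm. B] -/
theorem wAllExclAddWildRankOneSurj_of_restricted_of_valueOdd_of_controlLe (hF : PublishedInputsWildThree)
    (hE' : WildSplitEisensteinInclusionAtThreeRestricted) (hKoly : WildKolyvaginUpperAtThree)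
    (hVodd : ∀ (W : WeierstrassCurve ℚ) [W.IsElliptic] [W.IsGloballyMinimal] (N : ℕ) [NeZero N] (K : Type) [Field K] [NumberField K] (Dt : Literature.NumberTheory.EllipticCurves.ModularForms.ModularParametrizationData W N) (H : Literature.NumberTheory.EllipticCurves.HeegnerDatum N (NumberField.discr K)) (ι : K →+* ℂ) (P : (W.baseChange K).toAffine.Point), Summit.BirchSwinnertonDyer.Rank1Residual.Additive.ClassO6 W 3 → W.HasSurjectiveModNGaloisRep 3 → W.analyticRank = 1 → W.conductorNorm ℤ = N → Literature.NumberTheory.EllipticCurves.IsImaginaryQuadratic K → Literature.NumberTheory.EllipticCurves.SatisfiesHeegnerHypothesis N K → Odd (NumberField.discr K) → (W.quadraticTwist (NumberField.discr K : ℚ)).entireLFunction 1 ≠ 0 → (WeierstrassCurve.Affine.Point.map ι.toRatAlgHom) P = Literature.NumberTheory.EllipticCurves.ModularForms.heegnerPointComplex Dt H → ¬ IsOfFinAddOrder P → ∀ (κ : Literature.NumberTheory.EllipticCurves.ZpExtension K 3), κ.IsAnticyclotomic → ∀ (γ : Field.absoluteGaloisGroup K) [Fact (κ.IsTopGenerator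 γ)] (𝔭 : IsDedekindDomain.HeightOneSpectrum (NumberField.RingOfIntegers K)) (h𝔭 : ((3 : ℕ) : NumberField.RingOfIntegers K) ∈ 𝔭.asIdeal) (he : 𝔭.asIdeal.ramificationIdx (NumberField.RingOfIntegers ℚ) = 1) (hf : 𝔭.asIdeal.inertiaDeg (NumberField.RingOfIntegers ℚ) = 1), ∃ ι' : PadicAlgCl 3 ≃+* ℂ, Summit.BirchSwinnertonDyer.BirchSwinnertonDyer.Theorems.SchneiderFree.BranchInducesPrime 3 ι' 𝔭 ∧ ∃ (ΩK : ℂ) (Ωp : ℂ_[3]) (L : Literature.NumberTheory.EllipticCurves.UnrSeries 3), ΩK ≠ 0 ∧ Ωp ≠ 0 ∧ Literature.NumberTheory.EllipticCurves.IsBDPLFunction ι' 𝔭 κ γ Dt.f ΩK Ωp L ∧ ∃ u : (Literature.NumberTheory.EllipticCurves.unrIntegers 3)ˣ, L.HasValueAt 0 ((((u : Literature.NumberTheory.EllipticCurves.unrIntegers 3) : Literature.NumberTheory.EllipticCurves.unrIntegers 3) : ℂ_[3]) * (algebraMap ℚ_[3] ℂ_[3] (Summit.BirchSwinnertonDyer.Rank1Residual.X11b.Halves.logOmega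 W 3 (Summit.BirchSwinnertonDyer.Rank1Residual.X11b.embAt K 3 𝔭 h𝔭 he hf) P / (Dt.c : ℚ_[3]))) ^ 2))
    (hCle : ∀ (W : WeierstrassCurve ℚ) [W.IsElliptic] [W.IsGloballyMinimal] (N : ℕ) [NeZero N] (K : Type) [Field K] [NumberField K] (Dt : Literature.NumberTheory.EllipticCurves.ModularForms.ModularParametrizationData W N) (H : Literature.NumberTheory.EllipticCurves.HeegnerDatum N (NumberField.discr K)) (ι : K →+* ℂ) (P : (W.baseChange K).toAffine.Point), Summit.BirchSwinnertonDyer.Rank1Residual.Additive.ClassO6 W 3 → W.HasSurjectiveModNGaloisRep 3 → W.analyticRank = 1 → W.conductorNorm ℤ = N → Literature.NumberTheory.EllipticCurves.IsImaginaryQuadratic K → Literature.NumberTheory.EllipticCurves.SatisfiesHeegnerHypothesis N K → (W.quadraticTwist (NumberField.discr K : ℚ)).entireLFunction 1 ≠ 0 → (WeierstrassCurve.Affine.Point.map ι.toRatAlgHom) P = Literature.NumberTheory.EllipticCurves.ModularForms.heegnerPointComplex Dt H → ¬ IsOfFinAddOrder P → Literature.NumberTheory.EllipticCurves.kolyvagin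 N W K → ∀ (κ : Literature.NumberTheory.EllipticCurves.ZpExtension K 3), κ.IsAnticyclotomic → ∀ (γ : Field.absoluteGaloisGroup K) [Fact (κ.IsTopGenerator γ)] (𝔭 : IsDedekindDomain.HeightOneSpectrum (NumberField.RingOfIntegers K)) (h𝔭 : ((3 : ℕ) : NumberField.RingOfIntegers K) ∈ 𝔭.asIdeal) (he : 𝔭.asIdeal.ramificationIdx (NumberField.RingOfIntegers ℚ) = 1) (hf : 𝔭.asIdeal.inertiaDeg (NumberField.RingOfIntegers ℚ) = 1), Summit.BirchSwinnertonDyer.BirchSwinnertonDyer.Theorems.SchneiderFreeControlAtoms.AdditiveControlLeOnTreeAt 3 κ 𝔭 γ (Summit.BirchSwinnertonDyer.Rank1Residual.X11b.embAt K 3 𝔭 h𝔭 he hf) 0 P)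
    (hZ : WildRankZeroTwistAtThree) (hNT : WildRankOneSurjNonTowerAtThree) :
    Summit.BirchSwinnertonDyer.WAllExclAddWildRankOneSurj := by
  unfold Summit.BirchSwinnertonDyer.WAllExclAddWildRankOneSurj
  intro W _ _ hncm hO6 hsurj hr
  -- (o) TOWER SPLIT: off the tower-surjective rows the residual crux pays by name
  by_cases htower : AdditiveThree.TowerSurjThree W
  swap
  · exact hNT W hncm hO6 hsurj htower hr
  obtain ⟨hGZ, hKo, hGZK, hmod, hmodP, -, hGZ73, hFH, hpar, hHP⟩ := hF
  haveI hN0 : NeZero (W.conductorNorm ℤ) := ⟨W.conductorNorm_pos_holds.ne'⟩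
  -- (a) DATA. parity: `r_an = 1` is odd, so `w(E) = -1`
  have hw : W.rootNumber = -1 := by
    rcases W.rootNumber_eq_one_or with h | h
    · exfalso
      have heven : Even W.analyticRank := (hpar W).mpr h
      rw [hr] at heven
      exact Nat.not_even_one heven
    · exact h
  -- Friedberg–Hoffstein with auxiliary modulus `2`: Heegner for `N(E)`, `2` split, `L(E^{(d_K)},1) ≠ 0`
  obtain ⟨K, _, _, hK, -, hHN, hH2, hLt⟩ := hFH W hw 2 two_ne_zero 0
  have hodd : Odd (NumberField.discr K) := by
    have h8 := Literature.SatisfiesHeegnerHypothesis.discr_emod_eight hK.1 hH2 (dvd_refl 2)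
    rw [Int.odd_iff]; omega
  -- `3 ∣ N(E)` (additive) splits in `K`; hence `d_K ≠ -3`
  have h3N : 3 ∣ W.conductorNorm ℤ :=
    (W.dvd_conductorNorm_iff_not_hasGoodReductionAtPrime 3).mpr (not_good_of_addv W 3 hO6.2.1)
  have hsplit : SplitsIn K 3 := hHN 3 Nat.prime_three h3N
  have hd3 : NumberField.discr K ≠ -3 := by
    intro h
    exact Literature.SatisfiesHeegnerHypothesis.not_dvd_discr hK.1 hHN Nat.prime_three h3N
      (by rw [h]; norm_num)
  -- the Heegner point over `K` and its datum; non-torsion by Gross–Zagier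
  obtain ⟨P, Dt, H, ι, hP⟩ := hHP W K hK hHN
  have hL0 : W.entireLFunction 1 = 0 := entireLFunction_one_eq_zero_of_analyticRank_eq_one hr
  obtain ⟨-, hderiv⟩ := leadingLCoeff_eq_deriv_of_analyticRank_eq_one hr
  have hLK : LDerivEK W K ≠ 0 := by
    rw [lDerivEK_eq_deriv_mul W K hmod hL0]; exact mul_ne_zero hderiv hLt
  have hnt : ¬ IsOfFinAddOrder P :=
    (lDerivEK_ne_zero_iff_not_isOfFinAddOrder W (W.conductorNorm ℤ) K (hGZ _ W K) hK hHN
      ⟨Dt, H, ι, hP⟩).mp hLK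
  -- Kolyvagin: `rank E(K) = 1`, `Ш(E/K)` finite
  obtain ⟨hrk, hfin⟩ := hKo (W.conductorNorm ℤ) W K hK hHN ⟨Dt, H, ι, hP⟩ hnt
  -- a frame `(κ, γ, 𝔭)` and the other prime `𝔭′ ≠ 𝔭` above `3`
  obtain ⟨κ, γ, -, hκ, hγ, -⟩ := X11b.exists_anticyclotomic_generator_prime (p := 3) hK
  haveI : Fact (κ.IsTopGenerator γ) := ⟨hγ⟩
  obtain ⟨𝔭, h𝔭, he, hf⟩ := X11b.exists_degreeOnePrime_of_splitsIn K 3 hK.1 hsplit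
  obtain ⟨𝔭', hne, h𝔭', he', hf'⟩ := X11b.Three.exists_ne_degreeOne_prime hK.1 h𝔭 he hf
  -- (b) PLUMBING. frame AND unit value at `(κ, γ, 𝔭)` over the Friedberg–Hoffstein field (odd `d_K`) — the one
  -- place the kernel consumes crux #4, here through the displayed supplier `hVodd`
  obtain ⟨ι', hind, ΩK, Ωp, L, hΩK, hΩp, hBDP, u, hval⟩ :=
    hVodd W (W.conductorNorm ℤ) K Dt H ι P hO6 hsurj hr rfl hK hHN hodd hLt hP hnt κ hκ γ 𝔭 h𝔭 he hf
  -- the control INEQUALITY at `𝔭′` at slack `0` (CTL₀ included: it supplies the torsion guard and the generator)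
  have hctl : SchneiderFreeControlAtoms.AdditiveControlLeOnTreeAt 3 κ 𝔭' γ (embAt K 3 𝔭' h𝔭' he' hf') 0 P :=
    hCle W (W.conductorNorm ℤ) K Dt H ι P hO6 hsurj hr rfl hK hHN hLt hP hnt (hKo _ W K) κ hκ γ 𝔭'
      h𝔭' he' hf'
  obtain ⟨n, hn, hnle⟩ := hctl
  -- the value read through the logarithm at `𝔭′` (rank one: `(log_{𝔭′} P)² = (log_𝔭 P)²`)
  have hval' : L.HasValueAt 0 ((((u : unrIntegers 3) : unrIntegers 3) : ℂ_[3]) *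
      (algebraMap ℚ_[3] ℂ_[3]
        (logOmega W 3 (embAt K 3 𝔭' h𝔭' he' hf') P / (Dt.c : ℚ_[3]))) ^ 2) :=
    (SchneiderFreeAdditiveX3.hasValueAt_sq_logOmega_embAt_iff_of_rank_one W 3 hK.1 hrk h𝔭 he hf
      h𝔭' he' hf' P _ _ L).mpr hval
  -- the LOWER socket at slack `v₃(c)` at the frame `(κ, 𝔭′, γ, embAt 𝔭′)` — from crux #2′
  have hc0 : Dt.c ≠ 0 := Dt.maninConstant_ne_zero_holds
  have hlog : logOmega W 3 (embAt K 3 𝔭' h𝔭' he' hf') P ≠ 0 := X11b.R1.logOmega_ne_zero W 3 _ hnt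
  have hlow : SchneiderFree.AdditiveIMCLowerBDPOnTreeLeAt 3 κ 𝔭' γ (embAt K 3 𝔭' h𝔭' he' hf')
      (padicValNat 3 Dt.c.natAbs) P := by
    obtain ⟨htors, f, hfI, hf0, hfn⟩ := hn
    -- the RESTRICTED EISENSTEIN INCLUSION `Ch_Λ(X_(∅,0))·R₀⟦T⟧ ⊆ (L)` at the frame (crux #2′ by name, torsion-guarded),
    -- fed WITH the datum the kernel holds here (`H, ι, P`, `L(E^{(d_K)},1) ≠ 0`, `P = y_K`, `P` non-torsion)
    have hincl : (XAc.charIdeal (W.baseChange K) 3 κ 𝔭' ∅ γ).map (PowerSeries.map (toUnr 3)) ≤ Ideal.span {L} :=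
      hE' W (W.conductorNorm ℤ) K Dt H ι P hO6 hsurj hr rfl hK hHN hLt hP hnt κ hκ γ 𝔭 h𝔭 he hf 𝔭' h𝔭' hne ι' hind
        ΩK Ωp L hΩK hΩp hBDP htors
    have hmem : PowerSeries.map (toUnr 3) f ∈ Ideal.span {L} := by
      rw [hfI, CongruenceLimit.map_span_singleton_powerSeries] at hincl
      exact (Ideal.span_singleton_le_iff_mem _).mp hincl
    obtain ⟨-, hle⟩ := Supersingular.two_mul_valuation_le_of_mem_span 3 hf0 hmem u hval'
    have hc0' : (Dt.c : ℚ_[3]) ≠ 0 := by exact_mod_cast hc0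
    rw [div_eq_mul_inv, Padic.valuation_mul hlog (inv_ne_zero hc0'), Padic.valuation_inv,
      Padic.valuation_intCast, valuation_logOmega hlog, hfn] at hle
    refine ⟨n, ⟨htors, f, hfI, hf0, hfn⟩, ?_⟩
    simp only [padicValInt] at hle
    linarith
  -- STEP L at the Manin slack: the link consumes control ONLY as `≤` (utd-p3 g6, p593079 §3)
  have hlo : SchneiderFree.IndexLowerBoundLeAt W 3 K P (padicValNat 3 Dt.c.natAbs) :=
    AdditiveRankOneControlLe.indexLowerBoundLeAt_of_imcLowerLe_of_controlLe_zero rfl hK hHN hfin hlow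
      ⟨n, hn, hnle⟩
  -- the UPPER socket at slack `v₃(c)` IS the Kolyvagin crux (tower surjectivity, `d_K` odd, `≠ -3`)
  have hupI : SchneiderFree.Upper.IndexUpperBoundLeAt W 3 K P (padicValNat 3 Dt.c.natAbs) :=
    hKoly W (W.conductorNorm ℤ) K Dt H ι P hO6 hsurj hr rfl hK hHN hLt hP hnt hodd hd3 htower
  -- (c) TERMINAL STEP: a globally minimal model of the twist, then p528981
  have hD0 : (NumberField.discr K : ℚ) ≠ 0 := by exact_mod_cast NumberField.discr_ne_zero K
  haveI : (W.quadraticTwist (NumberField.discr K : ℚ)).IsElliptic := W.isElliptic_quadraticTwist hD0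
  obtain ⟨Cd, hCd⟩ := hasGlobalMinimalModel_rat_holds (W.quadraticTwist (NumberField.discr K : ℚ))
  haveI : (Cd • W.quadraticTwist (NumberField.discr K : ℚ)).IsGloballyMinimal := hCd
  exact SchneiderFree.Exact.bsdp_three_of_exactIndexManin_of_wAllExclAddWildRankZero hGZ hKo hGZK hmod
    hGZ73 hZ W hO6 hsurj hr (W.conductorNorm ℤ) K Dt H ι P
    (Cd • W.quadraticTwist (NumberField.discr K : ℚ)) rfl hK hodd hHN hLt hP ⟨Cd, rfl⟩ hlo hupI


/-! ### §2 The four feeds of the two suppliers -/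

/-- **Crux #4 V ⟹ the odd-`d_K` value supplier** (the parity binder is dropped). [folklore] -/
theorem valueOdd_of_waldspurger (hV : WildSplitWaldspurgerAtThree) :
    ∀ (W : WeierstrassCurve ℚ) [W.IsElliptic] [W.IsGloballyMinimal] (N : ℕ) [NeZero N] (K : Type) [Field K] [NumberField K] (Dt : Literature.NumberTheory.EllipticCurves.ModularForms.ModularParametrizationData W N) (H : Literature.NumberTheory.EllipticCurves.HeegnerDatum N (NumberField.discr K)) (ι : K →+* ℂ) (P : (W.baseChange K).toAffine.Point), Summit.BirchSwinnertonDyer.Rank1Residual.Additive.ClassO6 W 3 → W.HasSurjectiveModNGaloisRep 3 → W.analyticRank = 1 → W.conductorNorm ℤ = N → Literature.NumberTheory.EllipticCurves.IsImaginaryQuadratic K → Literature.NumberTheory.EllipticCurves.SatisfiesHeegnerHypothesis N K → Odd (NumberField.discr K) → (W.quadraticTwist (NumberField.discr K : ℚ)).entireLFunction 1 ≠ 0 → (WeierstrassCurve.Affine.Point.map ι.toRatAlgHom) P = Literature.NumberTheory.EllipticCurves.ModularForms.heegnerPointComplex Dt H → ¬ IsOfFinAddOrder P → ∀ (κ : Literature.NumberTheory.EllipticCurves.ZpExtension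 K 3), κ.IsAnticyclotomic → ∀ (γ : Field.absoluteGaloisGroup K) [Fact (κ.IsTopGenerator γ)] (𝔭 : IsDedekindDomain.HeightOneSpectrum (NumberField.RingOfIntegers K)) (h𝔭 : ((3 : ℕ) : NumberField.RingOfIntegers K) ∈ 𝔭.asIdeal) (he : 𝔭.asIdeal.ramificationIdx (NumberField.RingOfIntegers ℚ) = 1) (hf : 𝔭.asIdeal.inertiaDeg (NumberField.RingOfIntegers ℚ) = 1), ∃ ι' : PadicAlgCl 3 ≃+* ℂ, Summit.BirchSwinnertonDyer.BirchSwinnertonDyer.Theorems.SchneiderFree.BranchInducesPrime 3 ι' 𝔭 ∧ ∃ (ΩK : ℂ) (Ωp : ℂ_[3]) (L : Literature.NumberTheory.EllipticCurves.UnrSeries 3), ΩK ≠ 0 ∧ Ωp ≠ 0 ∧ Literature.NumberTheory.EllipticCurves.IsBDPLFunction ι' 𝔭 κ γ Dt.f ΩK Ωp L ∧ ∃ u : (Literature.NumberTheory.EllipticCurves.unrIntegers 3)ˣ, L.HasValueAt 0 ((((u : Literature.NumberTheory.EllipticCurves.unrIntegers 3) : Literature.NumberTheory.EllipticCurves.unrIntegers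 3) : ℂ_[3]) * (algebraMap ℚ_[3] ℂ_[3] (Summit.BirchSwinnertonDyer.Rank1Residual.X11b.Halves.logOmega W 3 (Summit.BirchSwinnertonDyer.Rank1Residual.X11b.embAt K 3 𝔭 h𝔭 he hf) P / (Dt.c : ℚ_[3]))) ^ 2) :=
  fun W _ _ N _ K _ _ Dt H ι P hO6 hsurj hr hN hK hHN _ hLt hP hnt κ hκ γ _ 𝔭 h𝔭 he hf ↦
    hV W N K Dt H ι P hO6 hsurj hr hN hK hHN hLt hP hnt κ hκ γ 𝔭 h𝔭 he hf

/-- **LZZ (item 20316's fact BY NAME) + an `R₀`-frame at odd `d_K` (item 20928's text + `Odd (discr K)`) ⟹ the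
odd-`d_K` value supplier**: the frame is read off `hFr`, the unit value is forced pointwise (p594734 §1
`exists_unit_hasValueAt_of_frame`). [cite: LiuZhangZhang2018, Thm 1.5.1 and Thm 1.5.3 (Duke Math. J. 167 pp. 748–749)] -/
theorem valueOdd_of_lzz_of_frameOdd (hLZZ : thm151_thm153_modularCurve_heegnerVector_additive)
    (hFr : ∀ (W : WeierstrassCurve ℚ) [W.IsElliptic] [W.IsGloballyMinimal] (N : ℕ) [NeZero N] (K : Type) [Field K] [NumberField K] (Dt : Literature.NumberTheory.EllipticCurves.ModularForms.ModularParametrizationData W N), Summit.BirchSwinnertonDyer.Rank1Residual.Additive.ClassO6 W 3 → W.conductorNorm ℤ = N → Literature.NumberTheory.EllipticCurves.IsImaginaryQuadratic K → Literature.NumberTheory.EllipticCurves.SatisfiesHeegnerHypothesis N K → Odd (NumberField.discr K) → ∀ (κ : Literature.NumberTheory.EllipticCurves.ZpExtension K 3), κ.IsAnticyclotomic → ∀ (γ : Field.absoluteGaloisGroup K) [Fact (κ.IsTopGenerator γ)] (𝔭 : IsDedekindDomain.HeightOneSpectrum (NumberField.RingOfIntegers K)), ((3 : ℕ) : NumberField.RingOfIntegers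 K) ∈ 𝔭.asIdeal → ∃ ι' : PadicAlgCl 3 ≃+* ℂ, Summit.BirchSwinnertonDyer.BirchSwinnertonDyer.Theorems.SchneiderFree.BranchInducesPrime 3 ι' 𝔭 ∧ ∃ (ΩK : ℂ) (Ωp : ℂ_[3]) (L : Literature.NumberTheory.EllipticCurves.UnrSeries 3), ΩK ≠ 0 ∧ Ωp ≠ 0 ∧ Literature.NumberTheory.EllipticCurves.IsBDPLFunction ι' 𝔭 κ γ Dt.f ΩK Ωp L) :
    ∀ (W : WeierstrassCurve ℚ) [W.IsElliptic] [W.IsGloballyMinimal] (N : ℕ) [NeZero N] (K : Type) [Field K] [NumberField K] (Dt : Literature.NumberTheory.EllipticCurves.ModularForms.ModularParametrizationData W N) (H : Literature.NumberTheory.EllipticCurves.HeegnerDatum N (NumberField.discr K)) (ι : K →+* ℂ) (P : (W.baseChange K).toAffine.Point), Summit.BirchSwinnertonDyer.Rank1Residual.Additive.ClassO6 W 3 → W.HasSurjectiveModNGaloisRep 3 → W.analyticRank = 1 → W.conductorNorm ℤ = N → Literature.NumberTheory.EllipticCurves.IsImaginaryQuadratic K → Literature.NumberTheory.EllipticCurves.SatisfiesHeegnerHypothesis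 N K → Odd (NumberField.discr K) → (W.quadraticTwist (NumberField.discr K : ℚ)).entireLFunction 1 ≠ 0 → (WeierstrassCurve.Affine.Point.map ι.toRatAlgHom) P = Literature.NumberTheory.EllipticCurves.ModularForms.heegnerPointComplex Dt H → ¬ IsOfFinAddOrder P → ∀ (κ : Literature.NumberTheory.EllipticCurves.ZpExtension K 3), κ.IsAnticyclotomic → ∀ (γ : Field.absoluteGaloisGroup K) [Fact (κ.IsTopGenerator γ)] (𝔭 : IsDedekindDomain.HeightOneSpectrum (NumberField.RingOfIntegers K)) (h𝔭 : ((3 : ℕ) : NumberField.RingOfIntegers K) ∈ 𝔭.asIdeal) (he : 𝔭.asIdeal.ramificationIdx (NumberField.RingOfIntegers ℚ) = 1) (hf : 𝔭.asIdeal.inertiaDeg (NumberField.RingOfIntegers ℚ) = 1), ∃ ι' : PadicAlgCl 3 ≃+* ℂ, Summit.BirchSwinnertonDyer.BirchSwinnertonDyer.Theorems.SchneiderFree.BranchInducesPrime 3 ι' 𝔭 ∧ ∃ (ΩK : ℂ) (Ωp : ℂ_[3]) (L : Literature.NumberTheory.EllipticCurves.UnrSeries 3), ΩK ≠ 0 ∧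 Ωp ≠ 0 ∧ Literature.NumberTheory.EllipticCurves.IsBDPLFunction ι' 𝔭 κ γ Dt.f ΩK Ωp L ∧ ∃ u : (Literature.NumberTheory.EllipticCurves.unrIntegers 3)ˣ, L.HasValueAt 0 ((((u : Literature.NumberTheory.EllipticCurves.unrIntegers 3) : Literature.NumberTheory.EllipticCurves.unrIntegers 3) : ℂ_[3]) * (algebraMap ℚ_[3] ℂ_[3] (Summit.BirchSwinnertonDyer.Rank1Residual.X11b.Halves.logOmega W 3 (Summit.BirchSwinnertonDyer.Rank1Residual.X11b.embAt K 3 𝔭 h𝔭 he hf) P / (Dt.c : ℚ_[3]))) ^ 2) := by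
  intro W _ _ N _ K _ _ Dt H ι P hO6 _ _ hN hK hHN hodd _ hP hnt κ hκ γ _ 𝔭 h𝔭 he hf
  obtain ⟨ι', hind, ΩK, Ωp, L, hΩK, hΩp, hBDP⟩ := hFr W N K Dt hO6 hN hK hHN hodd κ hκ γ 𝔭 h𝔭
  obtain ⟨u, hval⟩ := exists_unit_hasValueAt_of_frame hLZZ W N K Dt H ι P hO6 hN hK hHN hP hnt κ hκ γ 𝔭 h𝔭 he hf
    ι' hind hΩK hΩp hBDP
  exact ⟨ι', hind, ΩK, Ωp, L, hΩK, hΩp, hBDP, u, hval⟩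

/-- **Crux #5 C (the control EQUALITY) ⟹ the `≤`-control supplier** (p593079
`additiveControlLeOnTreeAt_zero_of_onTreeAt`). [folklore] -/
theorem controlLe_of_control (hC : WildSplitControlAtThree) :
    ∀ (W : WeierstrassCurve ℚ) [W.IsElliptic] [W.IsGloballyMinimal] (N : ℕ) [NeZero N] (K : Type) [Field K] [NumberField K] (Dt : Literature.NumberTheory.EllipticCurves.ModularForms.ModularParametrizationData W N) (H : Literature.NumberTheory.EllipticCurves.HeegnerDatum N (NumberField.discr K)) (ι : K →+* ℂ) (P : (W.baseChange K).toAffine.Point), Summit.BirchSwinnertonDyer.Rank1Residual.Additive.ClassO6 W 3 → W.HasSurjectiveModNGaloisRep 3 → W.analyticRank = 1 → W.conductorNorm ℤ = N → Literature.NumberTheory.EllipticCurves.IsImaginaryQuadratic K → Literature.NumberTheory.EllipticCurves.SatisfiesHeegnerHypothesis N K → (W.quadraticTwist (NumberField.discr K : ℚ)).entireLFunction 1 ≠ 0 → (WeierstrassCurve.Affine.Point.map ι.toRatAlgHom) P = Literature.NumberTheory.EllipticCurves.ModularForms.heegnerPointComplex Dt H → ¬ IsOfFinAddOrder P → Literature.NumberTheory.EllipticCurves.kolyvagin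 N W K → ∀ (κ : Literature.NumberTheory.EllipticCurves.ZpExtension K 3), κ.IsAnticyclotomic → ∀ (γ : Field.absoluteGaloisGroup K) [Fact (κ.IsTopGenerator γ)] (𝔭 : IsDedekindDomain.HeightOneSpectrum (NumberField.RingOfIntegers K)) (h𝔭 : ((3 : ℕ) : NumberField.RingOfIntegers K) ∈ 𝔭.asIdeal) (he : 𝔭.asIdeal.ramificationIdx (NumberField.RingOfIntegers ℚ) = 1) (hf : 𝔭.asIdeal.inertiaDeg (NumberField.RingOfIntegers ℚ) = 1), Summit.BirchSwinnertonDyer.BirchSwinnertonDyer.Theorems.SchneiderFreeControlAtoms.AdditiveControlLeOnTreeAt 3 κ 𝔭 γ (Summit.BirchSwinnertonDyer.Rank1Residual.X11b.embAt K 3 𝔭 h𝔭 he hf) 0 P :=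
  fun W _ _ N _ K _ _ Dt H ι P hO6 hsurj hr hN hK hHN hLt hP hnt hKv κ hκ γ _ 𝔭 h𝔭 he hf ↦
    AdditiveRankOneControlLe.additiveControlLeOnTreeAt_zero_of_onTreeAt
      (hC W N K Dt H ι P hO6 hsurj hr hN hK hHN hLt hP hnt hKv κ hκ γ 𝔭 h𝔭 he hf)

/-- **PT1 BY NAME (item 20461's text: Poitou–Tate duality for Selmer structures over every number field) ⟹ the
`≤`-control supplier**, at every frame of every Heegner datum of a curve additive at `3` (p593079 §2
`additiveControlLeOnTreeAt_of_poitouTate_of_heegner`; Kolyvagin's theorem for the datum is the supplier's own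
antecedent). No PT2, no local Euler–Poincaré fact, no Serre 1967, no reduction-type hypothesis beyond `Addv W 3`.
[cite: MilneADT2006, Ch. I, Thm. 4.10(b)] [cite: JetchevSkinnerWan2017, Thm. 3.3.1 (arXiv:1512.06894 p. 11)] -/
theorem controlLe_of_poitouTate
    (hPT : ∀ (K : Type) [Field K] [NumberField K], Literature.NumberTheory.GaloisCohomology.poitouTate_selmerStructure_duality K) :
    ∀ (W : WeierstrassCurve ℚ) [W.IsElliptic] [W.IsGloballyMinimal] (N : ℕ) [NeZero N] (K : Type) [Field K] [NumberField K] (Dt : Literature.NumberTheory.EllipticCurves.ModularForms.ModularParametrizationData W N) (H : Literature.NumberTheory.EllipticCurves.HeegnerDatum N (NumberField.discr K)) (ι : K →+* ℂ) (P : (W.baseChange K).toAffine.Point), Summit.BirchSwinnertonDyer.Rank1Residual.Additive.ClassO6 W 3 → W.HasSurjectiveModNGaloisRep 3 → W.analyticRank = 1 → W.conductorNorm ℤ = N → Literature.NumberTheory.EllipticCurves.IsImaginaryQuadratic K → Literature.NumberTheory.EllipticCurves.SatisfiesHeegnerHypothesis N K → (W.quadraticTwist (NumberField.discr K : ℚ)).entireLFunction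 1 ≠ 0 → (WeierstrassCurve.Affine.Point.map ι.toRatAlgHom) P = Literature.NumberTheory.EllipticCurves.ModularForms.heegnerPointComplex Dt H → ¬ IsOfFinAddOrder P → Literature.NumberTheory.EllipticCurves.kolyvagin N W K → ∀ (κ : Literature.NumberTheory.EllipticCurves.ZpExtension K 3), κ.IsAnticyclotomic → ∀ (γ : Field.absoluteGaloisGroup K) [Fact (κ.IsTopGenerator γ)] (𝔭 : IsDedekindDomain.HeightOneSpectrum (NumberField.RingOfIntegers K)) (h𝔭 : ((3 : ℕ) : NumberField.RingOfIntegers K) ∈ 𝔭.asIdeal) (he : 𝔭.asIdeal.ramificationIdx (NumberField.RingOfIntegers ℚ) = 1) (hf : 𝔭.asIdeal.inertiaDeg (NumberField.RingOfIntegers ℚ) = 1), Summit.BirchSwinnertonDyer.BirchSwinnertonDyer.Theorems.SchneiderFreeControlAtoms.AdditiveControlLeOnTreeAt 3 κ 𝔭 γ (Summit.BirchSwinnertonDyer.Rank1Residual.X11b.embAt K 3 𝔭 h𝔭 he hf) 0 P :=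
  fun W _ _ N _ K _ _ Dt H ι P hO6 _ _ hN hK hHN _ hP hnt hKv κ hκ γ _ 𝔭 h𝔭 he hf ↦
    AdditiveRankOneControlLe.additiveControlLeOnTreeAt_of_poitouTate_of_heegner W 3 (by norm_num) hO6.2.1 N K
      (hPT K) Dt H ι P hN hK hHN hP hnt hKv κ hκ γ 𝔭 h𝔭 he hf

/-! ### §3 The by-name kernels -/

/-- **SOED's restricted kernel with crux #5 replaced by PT1**: `PublishedInputsWildThree →
WildSplitEisensteinInclusionAtThreeRestricted → WildKolyvaginUpperAtThree → WildSplitWaldspurgerAtThree → PT1 (item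
20461's text) → WildRankZeroTwistAtThree → WildRankOneSurjNonTowerAtThree → WAllExclAddWildRankOneSurj`. Every crux /
fact is an antecedent; BSD is not proved by this. [cite: MilneADT2006, Ch. I, Thm. 4.10(b)]
[cite: JetchevSkinnerWan2017, §7.4.1 (arXiv:1512.06894 p. 30)] -/
theorem wAllExclAddWildRankOneSurj_of_restricted_of_waldspurger_of_poitouTate (hF : PublishedInputsWildThree)
    (hE' : WildSplitEisensteinInclusionAtThreeRestricted) (hKoly : WildKolyvaginUpperAtThree)
    (hV : WildSplitWaldspurgerAtThree)
    (hPT : ∀ (K : Type) [Field K] [NumberField K], Literature.NumberTheory.GaloisCohomology.poitouTate_selmerStructure_duality K)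
    (hZ : WildRankZeroTwistAtThree) (hNT : WildRankOneSurjNonTowerAtThree) :
    Summit.BirchSwinnertonDyer.WAllExclAddWildRankOneSurj :=
  wAllExclAddWildRankOneSurj_of_restricted_of_valueOdd_of_controlLe hF hE' hKoly (valueOdd_of_waldspurger hV)
    (controlLe_of_poitouTate hPT) hZ hNT

/-- **SOED's restricted kernel with BOTH shared cruxes replaced — #4 by {LZZ, one `R₀`-frame at odd `d_K`} and #5 by
PT1**: `PublishedInputsWildThree → WildSplitEisensteinInclusionAtThreeRestricted → WildKolyvaginUpperAtThree → LZZ (item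
20316's fact) → [frame at odd d_K: item 20928's text + Odd (discr K)] → PT1 (item 20461's text) →
WildRankZeroTwistAtThree → WildRankOneSurjNonTowerAtThree → WAllExclAddWildRankOneSurj`. Every crux / fact is an
antecedent; BSD is not proved by this. [cite: JetchevSkinnerWan2017, §7.4.1 (arXiv:1512.06894 p. 30)]
[cite: LiuZhangZhang2018, Thm 1.5.1 and Thm 1.5.3] [cite: MilneADT2006, Ch. I, Thm. 4.10(b)] -/
theorem wAllExclAddWildRankOneSurj_of_restricted_of_frameOdd_of_poitouTate (hF : PublishedInputsWildThree)
    (hE' : WildSplitEisensteinInclusionAtThreeRestricted) (hKoly : WildKolyvaginUpperAtThree)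
    (hLZZ : thm151_thm153_modularCurve_heegnerVector_additive)
    (hFr : ∀ (W : WeierstrassCurve ℚ) [W.IsElliptic] [W.IsGloballyMinimal] (N : ℕ) [NeZero N] (K : Type) [Field K] [NumberField K] (Dt : Literature.NumberTheory.EllipticCurves.ModularForms.ModularParametrizationData W N), Summit.BirchSwinnertonDyer.Rank1Residual.Additive.ClassO6 W 3 → W.conductorNorm ℤ = N → Literature.NumberTheory.EllipticCurves.IsImaginaryQuadratic K → Literature.NumberTheory.EllipticCurves.SatisfiesHeegnerHypothesis N K → Odd (NumberField.discr K) → ∀ (κ : Literature.NumberTheory.EllipticCurves.ZpExtension K 3), κ.IsAnticyclotomic → ∀ (γ : Field.absoluteGaloisGroup K) [Fact (κ.IsTopGenerator γ)] (𝔭 : IsDedekindDomain.HeightOneSpectrum (NumberField.RingOfIntegers K)), ((3 : ℕ) : NumberField.RingOfIntegers K) ∈ 𝔭.asIdeal → ∃ ι' : PadicAlgCl 3 ≃+* ℂ, Summit.BirchSwinnertonDyer.BirchSwinnertonDyer.Theorems.SchneiderFree.BranchInducesPrime 3 ι' 𝔭 ∧ ∃ (ΩK : ℂ) (Ωp : ℂ_[3])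 (L : Literature.NumberTheory.EllipticCurves.UnrSeries 3), ΩK ≠ 0 ∧ Ωp ≠ 0 ∧ Literature.NumberTheory.EllipticCurves.IsBDPLFunction ι' 𝔭 κ γ Dt.f ΩK Ωp L)
    (hPT : ∀ (K : Type) [Field K] [NumberField K], Literature.NumberTheory.GaloisCohomology.poitouTate_selmerStructure_duality K)
    (hZ : WildRankZeroTwistAtThree) (hNT : WildRankOneSurjNonTowerAtThree) :
    Summit.BirchSwinnertonDyer.WAllExclAddWildRankOneSurj :=
  wAllExclAddWildRankOneSurj_of_restricted_of_valueOdd_of_controlLe hF hE' hKoly (valueOdd_of_lzz_of_frameOdd hLZZ hFr)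
    (controlLe_of_poitouTate hPT) hZ hNT

/-- **Sanity: the item `EisensteinKernelAtThreeRestricted` (24156) chain from the core** (V ⟹ hVodd, C ⟹ hCle) — the
core subsumes the kernel′ of record. [folklore] -/
theorem wAllExclAddWildRankOneSurj_of_restricted_of_waldspurger_of_control (hF : PublishedInputsWildThree)
    (hE' : WildSplitEisensteinInclusionAtThreeRestricted) (hKoly : WildKolyvaginUpperAtThree)
    (hV : WildSplitWaldspurgerAtThree) (hC : WildSplitControlAtThree) (hZ : WildRankZeroTwistAtThree)
    (hNT : WildRankOneSurjNonTowerAtThree) : Summit.BirchSwinnertonDyer.WAllExclAddWildRankOneSurj :=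
  wAllExclAddWildRankOneSurj_of_restricted_of_valueOdd_of_controlLe hF hE' hKoly (valueOdd_of_waldspurger hV)
    (controlLe_of_control hC) hZ hNT

end Summit.BirchSwinnertonDyer.BirchSwinnertonDyer.Theorems.EisensteinKernelAtThreeRestrictedOfControlLe

end
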